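import Mathlib.Geometry.Manifold.Complex
import Literature.Geometry.Kaehler.HolomorphicChartForms
import Literature.Geometry.Kaehler.ManifoldFormsChart
import Literature.NumberTheory.Transcendental.ComplexFormsProofs
import HarnessLib

/-!
# Closed `(1,0)`-forms on a compact complex curve carrying a nowhere-vanishing holomorphic `1`-form

Family `hodge` / trunk Kähler, layer `Literature/Geometry/Kaehler`. Let `M` be a complex manifold
charted on the complex normed space `E` with `dim_ℂ E = 1` (a complex CURVE), with its complex
`k`-forms `MForm 𝓘(ℝ, E) M ℂ k`, the type predicate `IsOfType p q`
(`NumberTheory/Transcendental/ComplexForms`), the chart-level holomorphy predicate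
`IsHolomorphicInCharts` (`HolomorphicChartForms`) and the Hodge pieces
`hodgePQ E M k p q ⊆ H^k_dR(M; ℂ)` (spans of the classes of closed forms of type `(p,q)`).

Suppose `ω₀` is a `1`-form holomorphic in charts which vanishes at NO point of `M` (on a curve:
`ω₀ x ≠ 0` for all `x`). This file PROVES (theorems only; no definitions, no named facts):

* `eq_oneFormRatio_smul` — every `1`-form `α` of type `(1,0)` is `α = f · ω₀` for the function
  `f = α(e)/ω₀(e)` (`e ≠ 0` any vector of the line `E`): two `ℂ`-linear functionals on a complex
  line are proportional;
* `mdifferentiable_oneFormRatio` — if moreover `α` is smooth and CLOSED, then `f` is holomorphic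
  (`MDifferentiable 𝓘(ℂ, E) 𝓘(ℂ, ℂ) f`): in a chart, `0 = d(fω₀) = df ∧ ω₀` (`dω₀ = 0`, a
  holomorphic top-degree form being closed), and `(df ∧ ω₀)(e, ie) = (i ∂ₑf - ∂_{ie}f) ω₀(e)` with
  `ω₀(e) ≠ 0`, so `df` is `ℂ`-linear;
* `exists_eq_const_smul_of_isClosed` — on a COMPACT CONNECTED curve, `f` is constant
  (Mathlib's `MDifferentiable.exists_eq_const_of_compactSpace`, the maximum principle), so every
  closed smooth `(1,0)`-form is a constant multiple of `ω₀`;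
* `hodgePQ_one_zero_le_span`, `finrank_hodgePQ_one_zero_le_one`, and by conjugation
  `hodgePQ_zero_one_le_span`, `finrank_hodgePQ_zero_one_le_one` — hence
  **`dim H^{1,0} ≤ 1` and `dim H^{0,1} ≤ 1`** for such a curve.

In print: the quotient of two abelian differentials is a (mero)morphic function — Farkas–Kra,
*Riemann Surfaces*, II.5.2–II.5.3 (proof of the Corollary of II.5.3, book p. 51: "Set
`f = ω₁/ω₂`") — and a holomorphic function on a compact Riemann surface is constant (ibid.,
I.1.5, Theorem, book p. 11: "`ℋ(M) = ℂ`"; Mathlib's maximum-principle form); so with a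
nowhere-vanishing `ω₀` every holomorphic `1`-form is `c ω₀` (the genus-one situation: a smooth
plane cubic with its residue form `Res(Ω/F)`, or a torus with `dz`). That a CLOSED `(1,0)`-form
on a curve is holomorphic is the type computation `dα = ∂̄α` for `α ∈ A^{1,0}` of a curve
(Voisin I, §2.3.1–2.3.3), done here directly in a chart. The consumer is
`AlgebraicGeometry/HodgeTheory/PlaneCubicFirstBetti` (`b₁ ≤ 2` for smooth plane cubics on the
tree's real carriers).

## References

* [FarkasKra1992] H. M. Farkas, I. Kra, Riemann Surfaces, 2nd ed., GTM 71, Springer (1992),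
  I.1.5 (Theorem: `ℋ(M) = ℂ` for `M` compact), II.5.2–II.5.3 (q-differentials; `f = ω₁/ω₂`).
  (Held text `book:farkas1992-riemann-surfaces`, PDF pp. 18, 53–54.)
* [VoisinHodgeI2002] C. Voisin, Hodge Theory and Complex Algebraic Geometry I (2002), §2.3.1–2.3.3,
  Cor. 7.6 (proof: holomorphic top forms are closed).
-/

noncomputable section

open scoped Manifold ContDiff Topology
open Set Filter Complex
open Literature.NumberTheory.Transcendental

namespace Literature.Geometry.Kaehler

variable {E : Type*} [NormedAddCommGroup E] [NormedSpace ℂ E]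

/-! ### Linear algebra on a complex line, seen as a real vector space -/

section Line

/-- A one-dimensional space has a non-zero vector. [folklore] -/
theorem exists_ne_zero_of_finrank_eq_one (h : Module.finrank ℂ E = 1) : ∃ e : E, e ≠ 0 := by
  by_contra hcon
  push Not at hcon
  have : Module.finrank ℂ E = 0 := Module.finrank_eq_zero_of_rank_eq_zero (by
    rw [rank_eq_zero_iff]
    exact fun x ↦ ⟨1, one_ne_zero, by rw [hcon x, smul_zero]⟩)
  omega

/-- Additivity of a real-alternating `1`-form in its single slot. [folklore] -/
theorem oneForm_apply_add (f : E [⋀^Fin 1]→L[ℝ] ℂ) (u w : E) : f ![u + w] = f ![u] + f ![w] := by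
  simpa using f.toContinuousMultilinearMap.cons_add ![] u w

/-- Real homogeneity of a real-alternating `1`-form in its single slot. [folklore] -/
theorem oneForm_apply_real_smul (f : E [⋀^Fin 1]→L[ℝ] ℂ) (r : ℝ) (w : E) :
    f ![(r : ℂ) • w] = (r : ℂ) * f ![w] := by
  rw [Complex.coe_smul]
  simpa using f.toContinuousMultilinearMap.cons_smul ![] r w

/-- A real-alternating `1`-form on a complex space which commutes with `i` is `ℂ`-homogeneous:
`f(cv) = c f(v)` (write `c = a + bi`). [folklore] -/
theorem oneForm_apply_smul_of_apply_I_smul (f : E [⋀^Fin 1]→L[ℝ] ℂ)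
    (hI : ∀ v : E, f ![I • v] = I * f ![v]) (c : ℂ) (v : E) :
    f ![c • v] = c * f ![v] := by
  conv_lhs => rw [← Complex.re_add_im c]
  rw [add_smul, oneForm_apply_add, oneForm_apply_real_smul, mul_smul, oneForm_apply_real_smul, hI]
  conv_rhs => rw [← Complex.re_add_im c]
  ring

/-- A real-alternating `1`-form evaluated on `v : Fin 1 → E` only sees `v 0`. [folklore] -/
theorem oneForm_apply_eq (f : E [⋀^Fin 1]→L[ℝ] ℂ) (v : Fin 1 → E) : f v = f ![v 0] := by
  congr 1
  funext i
  fin_cases i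
  rfl

/-- **Two `ℂ`-homogeneous real `1`-forms on a complex line are proportional**: if `dim_ℂ E = 1`,
`f`, `g` commute with `i` and `g(e) ≠ 0`, then `f = (f(e)/g(e)) · g`. [folklore] -/
theorem oneForm_eq_smul_of_line (h1 : Module.finrank ℂ E = 1) {f g : E [⋀^Fin 1]→L[ℝ] ℂ}
    (hf : ∀ v : E, f ![I • v] = I * f ![v]) (hg : ∀ v : E, g ![I • v] = I * g ![v]) {e : E}
    (he : g ![e] ≠ 0) : f = (f ![e] / g ![e]) • g := by
  have he0 : e ≠ 0 := by
    rintro rfl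
    apply he
    simpa using oneForm_apply_real_smul g 0 (0 : E)
  ext v
  obtain ⟨c, hc⟩ := (finrank_eq_one_iff_of_nonzero' e he0).1 h1 (v 0)
  have hv : v = ![v 0] := by
    funext i
    fin_cases i
    rfl
  rw [hv, ContinuousAlternatingMap.smul_apply, ← hc, oneForm_apply_smul_of_apply_I_smul f hf,
    oneForm_apply_smul_of_apply_I_smul g hg, smul_eq_mul]
  field_simp

/-- **A real-linear functional on a complex line which commutes with `i` on a generator is
`ℂ`-linear**: if `dim_ℂ E = 1`, `e ≠ 0` and `L(ie) = i L(e)`, then `L` is the restriction of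
scalars of a `ℂ`-linear functional. [folklore] -/
theorem exists_restrictScalars_eq_of_line (h1 : Module.finrank ℂ E = 1) {e : E} (he : e ≠ 0)
    (L : E →L[ℝ] ℂ) (hL : L (I • e) = I * L e) :
    ∃ L' : E →L[ℂ] ℂ, L'.restrictScalars ℝ = L := by
  -- `L (z • e) = z * L e` for every complex `z`
  have hz : ∀ z : ℂ, L (z • e) = z * L e := by
    intro z
    conv_lhs => rw [← Complex.re_add_im z]
    rw [add_smul, map_add, mul_smul, Complex.coe_smul, Complex.coe_smul, L.map_smul, L.map_smul, hL]
    conv_rhs => rw [← Complex.re_add_im z]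
    simp only [Complex.real_smul]
    ring
  have hsm : ∀ (c : ℂ) (v : E), L (c • v) = c * L v := by
    intro c v
    obtain ⟨w, rfl⟩ := (finrank_eq_one_iff_of_nonzero' e he).1 h1 v
    rw [smul_smul, hz, hz, mul_assoc]
  refine ⟨⟨⟨⟨L, L.map_add⟩, fun c v ↦ by simpa using hsm c v⟩, L.continuous⟩, ?_⟩
  ext v
  rfl

/-- On a complex line, a non-zero real `1`-form commuting with `i` is non-zero on every non-zero
vector. [folklore] -/
theorem oneForm_apply_ne_zero (h1 : Module.finrank ℂ E = 1) {f : E [⋀^Fin 1]→L[ℝ] ℂ}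
    (hf : ∀ v : E, f ![I • v] = I * f ![v]) (hne : f ≠ 0) {e : E} (he : e ≠ 0) : f ![e] ≠ 0 := by
  intro h0
  apply hne
  ext v
  obtain ⟨c, hc⟩ := (finrank_eq_one_iff_of_nonzero' e he).1 h1 (v 0)
  rw [oneForm_apply_eq f, ← hc, oneForm_apply_smul_of_apply_I_smul f hf, h0, mul_zero]
  rfl

end Line

/-! ### Pointwise: a `(1,0)`-form is a function multiple of a nowhere-vanishing holomorphic `1`-form -/

section Pointwise

variable {M : Type*} [TopologicalSpace M] [ChartedSpace E M]

/-- A `1`-form of type `(1,0)` commutes with `i`: `α(iv) = i α(v)` (the weight-`1` transformation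
rule at `θ = π/2`). [cite: VoisinHodgeI2002, §2.3.1] -/
theorem _root_.Literature.NumberTheory.Transcendental.IsOfType.apply_I_smul
    {α : MForm 𝓘(ℝ, E) M ℂ 1} (hα : IsOfType 1 0 α) (x : M) (v : E) :
    α x ![(I • v : E)] = I * α x ![v] := by
  have h := hα.2 x (Real.pi / 2) ![v]
  have hexp : Complex.exp (((Real.pi / 2 : ℝ) : ℂ) * I) = I := by
    rw [Complex.exp_mul_I]
    push_cast
    rw [Complex.cos_pi_div_two, Complex.sin_pi_div_two]
    simp
  have key : α x ![(I • v : E)] =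
      α x (fun i ↦ tangentRotate E x (Real.pi / 2)
        ((![v] : Fin 1 → TangentSpace 𝓘(ℝ, E) x) i)) := by
    congr 1
    funext i
    fin_cases i
    simp [tangentRotate_apply]
  rw [key.trans h]
  simp only [Nat.cast_one, Nat.cast_zero, sub_zero, Int.cast_one, one_mul, hexp]

/-- A form holomorphic in charts commutes with `i` in each slot; degree one:
`ω(iv) = i ω(v)` (its values are `ℂ`-linear, `IsHolomorphicInCharts.exists_apply_eq_restrictScalars`).
[folklore] -/
theorem IsHolomorphicInCharts.apply_I_smul [IsManifold 𝓘(ℝ, E) ∞ M] {ω₀ : MForm 𝓘(ℝ, E) M ℂ 1}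
    (hω : IsHolomorphicInCharts ω₀) (x : M) (v : E) : ω₀ x ![(I • v : E)] = I * ω₀ x ![v] := by
  obtain ⟨a, ha⟩ := hω.exists_apply_eq_restrictScalars x
  rw [ha]
  change a ![I • v] = I * a ![v]
  simpa using a.toContinuousMultilinearMap.cons_smul ![] I v

variable {α ω₀ : MForm 𝓘(ℝ, E) M ℂ 1} {e : E}

/-- **`α = f · ω₀` pointwise** for `α` of type `(1,0)`, `ω₀` holomorphic in charts and nowhere zero
on the curve `M` (`dim_ℂ E = 1`), with `f x = α x (e) / ω₀ x (e)` for any fixed `e ≠ 0`.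
[cite: FarkasKra1992, II.5.2] -/
theorem eq_oneFormRatio_smul [IsManifold 𝓘(ℝ, E) ∞ M] (h1 : Module.finrank ℂ E = 1)
    (hα : IsOfType 1 0 α) (hω : IsHolomorphicInCharts ω₀) (hne : ∀ x, ω₀ x ≠ 0) (he : e ≠ 0)
    (x : M) : α x = (α x ![e] / ω₀ x ![e]) • ω₀ x :=
  oneForm_eq_smul_of_line h1 (hα.apply_I_smul x) (hω.apply_I_smul x)
    (oneForm_apply_ne_zero h1 (hω.apply_I_smul x) (hne x) he)

end Pointwise

/-! ### Holomorphy of the quotient of a closed `(1,0)`-form by a nowhere-zero holomorphic one -/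

section Chart

variable {M : Type*} [TopologicalSpace M] [ChartedSpace E M] [IsManifold 𝓘(ℝ, E) ∞ M]

/-- The real derivative of a complex-analytic scalar germ commutes with `i`. [folklore] -/
theorem fderiv_real_apply_I_smul_of_analyticAt {γ : E → ℂ} {y : E} (hγ : AnalyticAt ℂ γ y)
    (v : E) : fderiv ℝ γ y (I • v) = I * fderiv ℝ γ y v := by
  rw [(hγ.differentiableAt.hasFDerivAt.restrictScalars ℝ).fderiv]
  simp

/-- A `ℂ`-alternating `1`-form commutes with `i` in its slot. [folklore] -/
theorem complexOneForm_apply_I_smul (a : E [⋀^Fin 1]→L[ℂ] ℂ) (v : E) :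
    a ![I • v] = I * a ![v] := by
  simpa using a.toContinuousMultilinearMap.cons_smul ![] I v

/-- **The quotient of a closed `(1,0)`-form by a nowhere-vanishing holomorphic `1`-form is
holomorphic.** On a complex curve `M` (`dim_ℂ E = 1`), let `ω₀` be a `1`-form holomorphic in
charts with `ω₀ x ≠ 0` for all `x`, and `α` a smooth closed `1`-form of type `(1,0)`. Then
`f = α(e)/ω₀(e)` (`α = f · ω₀`, `eq_oneFormRatio_smul`) is complex differentiable at every
point. In the chart at `x₀` write `α = F · G`, `G` the (holomorphic) representative of
`ω₀`; then `0 = dα(e, ie) = ∂ₑ(F G(ie)) - ∂_{ie}(F G(e)) = (i ∂ₑF - ∂_{ie}F) · G(e)` because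
`G(ie) = i G(e)` and `G(e)` is holomorphic, so `dF(ie) = i dF(e)`: `dF` is `ℂ`-linear on the line
`E`. [cite: FarkasKra1992, II.5.3 (proof of the Corollary)] [cite: VoisinHodgeI2002, §2.3.3] -/
theorem mdifferentiableAt_oneFormRatio (h1 : Module.finrank ℂ E = 1) {α ω₀ : MForm 𝓘(ℝ, E) M ℂ 1}
    (hαs : IsSmoothForm α) (hαc : IsClosedForm α) (hα : IsOfType 1 0 α)
    (hω : IsHolomorphicInCharts ω₀) (hne : ∀ x, ω₀ x ≠ 0) {e : E} (he : e ≠ 0) (x₀ : M) :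
    MDifferentiableAt 𝓘(ℂ, E) 𝓘(ℂ, ℂ) (fun x ↦ α x ![e] / ω₀ x ![e]) x₀ := by
  set f : M → ℂ := fun x ↦ α x ![e] / ω₀ x ![e] with hfdef
  set φ := extChartAt 𝓘(ℝ, E) x₀ with hφ
  set y₀ : E := φ x₀ with hy₀
  set A : E → E [⋀^Fin 1]→L[ℝ] ℂ := α.inChart x₀ with hA
  set G : E → E [⋀^Fin 1]→L[ℝ] ℂ := ω₀.inChart x₀ with hG
  set F : E → ℂ := f ∘ φ.symm with hF
  have hy₀t : y₀ ∈ φ.target := mem_extChartAt_target x₀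
  have hsymm : φ.symm y₀ = x₀ := extChartAt_to_inv x₀
  -- (1) `A = F • G` everywhere (the chart representative is linear over the functions)
  have hAFG : ∀ y, A y = F y • G y := by
    intro y
    simp only [hA, hG, hF, MForm.inChart, Function.comp_apply]
    rw [eq_oneFormRatio_smul h1 hα hω hne he (φ.symm y)]
    ext v
    rfl
  -- (2) the holomorphic germ `g` of `G` at the centre, and the scalar germ `γ = g(e)`
  obtain ⟨g, hg, hGg⟩ := hω x₀
  change AnalyticAt ℂ g y₀ at hg
  change G =ᶠ[𝓝 y₀] fun y ↦ (g y).restrictScalars ℝ at hGg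
  set γ : E → ℂ := fun y ↦ g y ![e] with hγ
  have hγan : AnalyticAt ℂ γ y₀ :=
    ((ContinuousAlternatingMap.apply ℂ E ℂ ![e]).analyticAt _).comp hg
  have hGy₀ : G y₀ = (g y₀).restrictScalars ℝ := hGg.self_of_nhds
  have hγ0 : γ y₀ ≠ 0 := by
    -- `G y₀ = ω₀ x₀ ≠ 0`, and `γ y₀ = G y₀ (e)`
    have h : G y₀ = ω₀ x₀ := MForm.inChart_apply_self ω₀ x₀
    have hGne : G y₀ ≠ 0 := fun h0 ↦ hne x₀ (h.symm.trans h0)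
    have hGI : ∀ v : E, G y₀ ![I • v] = I * G y₀ ![v] := fun v ↦ by
      rw [hGy₀, ContinuousAlternatingMap.coe_restrictScalars, complexOneForm_apply_I_smul]
    have key := oneForm_apply_ne_zero h1 hGI hGne he
    rw [hGy₀, ContinuousAlternatingMap.coe_restrictScalars] at key
    exact key
  -- the two scalar slots of `A`
  set a₁ : E → ℂ := fun y ↦ A y ![e] with ha₁def
  set a₂ : E → ℂ := fun y ↦ A y ![I • e] with ha₂def
  have ha₁ : a₁ =ᶠ[𝓝 y₀] fun y ↦ F y * γ y := by
    filter_upwards [hGg] with y hy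
    simp only [ha₁def, hAFG y, hy, ContinuousAlternatingMap.smul_apply, smul_eq_mul, hγ,
      ContinuousAlternatingMap.coe_restrictScalars]
  have ha₂ : a₂ =ᶠ[𝓝 y₀] fun y ↦ I * a₁ y := by
    filter_upwards [hGg] with y hy
    simp only [ha₂def, ha₁def, hAFG y, hy, ContinuousAlternatingMap.smul_apply, smul_eq_mul,
      ContinuousAlternatingMap.coe_restrictScalars]
    rw [complexOneForm_apply_I_smul]
    ring
  -- (3) `A` is `C^∞` at every point of the chart target (smoothness of `α` transported)
  have hAsm : ∀ y ∈ φ.target, ContDiffAt ℝ ∞ A y := by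
    intro y hy
    have hz : φ.symm y ∈ φ.source := φ.map_target hy
    have h := MForm.SmoothAt.contDiffWithinAt_inChart (α := α) (x₀ := x₀) hz (hαs (φ.symm y))
    rw [φ.right_inv hy, ModelWithCorners.Boundaryless.range_eq_univ] at h
    exact h.contDiffAt univ_mem
  have hAd : DifferentiableAt ℝ A y₀ := (hAsm y₀ hy₀t).differentiableAt (by simp)
  have ha₁d : DifferentiableAt ℝ a₁ y₀ :=
    ((ContinuousAlternatingMap.apply ℝ E ℂ ![e]).differentiableAt).comp y₀ hAd
  -- (4) closedness read in the chart: `extDeriv A y₀ = 0`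
  have hdA : extDeriv A y₀ = 0 := by
    have h := inChart_mextDeriv_of_mem_target α hy₀t (by rw [hsymm]; exact hαs x₀)
    have h0 : mextDeriv α = 0 := hαc
    rw [h0, MForm.inChart_zero, ModelWithCorners.Boundaryless.range_eq_univ,
      extDerivWithin_univ] at h
    exact h.symm
  -- (5) `∂_{ie} a₁ = i ∂ₑ a₁`
  have hr0 : Fin.removeNth (0 : Fin 2) ![e, I • e] = ![I • e] := by
    funext j; fin_cases j; rfl
  have hr1 : Fin.removeNth (1 : Fin 2) ![e, I • e] = ![e] := by
    funext j; fin_cases j; rfl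
  have hkey₁ : fderiv ℝ a₁ y₀ (I • e) = I * fderiv ℝ a₁ y₀ e := by
    have h := extDeriv_apply hAd ![e, I • e]
    rw [hdA] at h
    simp only [ContinuousAlternatingMap.coe_zero, Pi.zero_apply, Fin.sum_univ_succ,
      Fin.sum_univ_zero, Fin.val_zero, pow_zero, one_smul, Fin.val_succ, Fin.succ_zero_eq_one,
      zero_add, pow_one, neg_smul, Matrix.cons_val_zero, Matrix.cons_val_succ,
      Matrix.cons_val_fin_one, hr0, hr1, add_zero] at h
    -- `h : 0 = fderiv a₂ y₀ e - fderiv a₁ y₀ (ie)`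
    have h2 : fderiv ℝ a₂ y₀ = I • fderiv ℝ a₁ y₀ := by
      rw [ha₂.fderiv_eq]
      exact fderiv_const_mul ha₁d I
    change (0 : ℂ) = fderiv ℝ a₂ y₀ e + -(fderiv ℝ a₁ y₀ (I • e)) at h
    rw [h2, FunLike.coe_smul, Pi.smul_apply, smul_eq_mul] at h
    linear_combination h
  -- (6) `F = a₁ · γ⁻¹` near `y₀`, so `F` is real differentiable there with `ℂ`-linear derivative
  have hγne : ∀ᶠ y in 𝓝 y₀, γ y ≠ 0 := hγan.continuousAt.eventually_ne hγ0
  have hFeq : F =ᶠ[𝓝 y₀] fun y ↦ a₁ y * (γ y)⁻¹ := by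
    filter_upwards [ha₁, hγne] with y hy hyne
    rw [hy, mul_inv_cancel_right₀ hyne]
  have hγinv : AnalyticAt ℂ (fun y ↦ (γ y)⁻¹) y₀ := hγan.inv hγ0
  have hγinvd : DifferentiableAt ℝ (fun y ↦ (γ y)⁻¹) y₀ :=
    hγinv.differentiableAt.restrictScalars ℝ
  have hFd : DifferentiableAt ℝ F y₀ := (ha₁d.mul hγinvd).congr_of_eventuallyEq hFeq
  have hkey₂ : fderiv ℝ F y₀ (I • e) = I * fderiv ℝ F y₀ e := by
    rw [hFeq.fderiv_eq, fderiv_fun_mul ha₁d hγinvd]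
    simp only [add_apply, FunLike.coe_smul, Pi.smul_apply, smul_eq_mul]
    rw [fderiv_real_apply_I_smul_of_analyticAt hγinv, hkey₁]
    ring
  obtain ⟨L', hL'⟩ := exists_restrictScalars_eq_of_line h1 he (fderiv ℝ F y₀) hkey₂
  have hFdC : DifferentiableAt ℂ F y₀ := (differentiableAt_iff_restrictScalars ℝ hFd).2 ⟨L', hL'⟩
  -- (7) conclusion
  rw [mdifferentiableAt_iff]
  refine ⟨?_, ?_⟩
  · -- continuity: `f = F ∘ φ` near `x₀`
    have hev : (F ∘ φ) =ᶠ[𝓝 x₀] f := by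
      filter_upwards [extChartAt_source_mem_nhds (I := 𝓘(ℝ, E)) x₀] with x hx
      simp only [hF, Function.comp_apply, φ.left_inv hx]
    exact (hFdC.continuousAt.comp (continuousAt_extChartAt (I := 𝓘(ℝ, E)) x₀)).congr hev
  · simp only [writtenInExtChartAt, extChartAt_model_space_eq_id, PartialEquiv.refl_coe,
      CompTriple.comp_eq]
    exact hFdC.differentiableWithinAt

/-- Hence the quotient function is holomorphic on all of `M`.
[cite: FarkasKra1992, II.5.3 (proof of the Corollary)] -/
theorem mdifferentiable_oneFormRatio (h1 : Module.finrank ℂ E = 1) {α ω₀ : MForm 𝓘(ℝ, E) M ℂ 1}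
    (hαs : IsSmoothForm α) (hαc : IsClosedForm α) (hα : IsOfType 1 0 α)
    (hω : IsHolomorphicInCharts ω₀) (hne : ∀ x, ω₀ x ≠ 0) {e : E} (he : e ≠ 0) :
    MDifferentiable 𝓘(ℂ, E) 𝓘(ℂ, ℂ) (fun x ↦ α x ![e] / ω₀ x ![e]) := fun x ↦
  mdifferentiableAt_oneFormRatio h1 hαs hαc hα hω hne he x

end Chart

/-! ### Compact connected curves: `dim H^{1,0} ≤ 1`, `dim H^{0,1} ≤ 1` -/

section Global

variable [FiniteDimensional ℂ E] {M : Type*} [TopologicalSpace M] [ChartedSpace E M]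
  [IsManifold 𝓘(ℂ, E) ω M] [IsManifold 𝓘(ℝ, E) ∞ M] [CompactSpace M] [PreconnectedSpace M]

omit [FiniteDimensional ℂ E] in
/-- **On a compact connected complex curve with a nowhere-vanishing holomorphic `1`-form `ω₀`,
every closed smooth `(1,0)`-form is a constant multiple of `ω₀`**: the holomorphic quotient
`α/ω₀` (`mdifferentiable_oneFormRatio`) is constant by the maximum principle
(`MDifferentiable.exists_eq_const_of_compactSpace`).
[cite: FarkasKra1992, I.1.5 (Theorem) and II.5.3 (proof of the Corollary)] -/
theorem exists_eq_const_smul_of_isClosedForm (h1 : Module.finrank ℂ E = 1)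
    {α ω₀ : MForm 𝓘(ℝ, E) M ℂ 1} (hαs : IsSmoothForm α) (hαc : IsClosedForm α)
    (hα : IsOfType 1 0 α) (hω : IsHolomorphicInCharts ω₀) (hne : ∀ x, ω₀ x ≠ 0) :
    ∃ c : ℂ, α = c • ω₀ := by
  obtain ⟨e, he⟩ := exists_ne_zero_of_finrank_eq_one h1
  obtain ⟨c, hc⟩ := (mdifferentiable_oneFormRatio h1 hαs hαc hα hω hne he
    ).exists_eq_const_of_compactSpace (I := 𝓘(ℂ, E))
  refine ⟨c, funext fun x ↦ ?_⟩
  have hcx : α x ![e] / ω₀ x ![e] = c := congrFun hc x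
  rw [eq_oneFormRatio_smul h1 hα hω hne he x, hcx]
  rfl

/-- **`H^{1,0} ⊆ ℂ · [ω₀]`** on a compact connected complex curve carrying a nowhere-vanishing
holomorphic `1`-form `ω₀` (itself closed, smooth and of type `(1,0)`:
`IsHolomorphicInCharts.mem_cclosedSmoothForms`). [cite: FarkasKra1992, I.1.5 and II.5.3] -/
theorem hodgePQ_one_one_zero_le_span (h1 : Module.finrank ℂ E = 1) {ω₀ : MForm 𝓘(ℝ, E) M ℂ 1}
    (hω : IsHolomorphicInCharts ω₀) (hne : ∀ x, ω₀ x ≠ 0) :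
    hodgePQ E M 1 1 0 ≤
      ℂ ∙ complexDeRhamCohomology.mk E M 1 ⟨ω₀, hω.mem_cclosedSmoothForms h1⟩ := by
  rw [hodgePQ]
  refine Submodule.span_le.2 ?_
  rintro _ ⟨α, hα, rfl⟩
  obtain ⟨hs, hc⟩ := (mem_cclosedSmoothForms_iff α.1).1 α.2
  obtain ⟨c, hcα⟩ := exists_eq_const_smul_of_isClosedForm h1 hs hc hα hω hne
  have hα' : α = c • ⟨ω₀, hω.mem_cclosedSmoothForms h1⟩ := Subtype.ext hcα
  rw [hα', map_smul]
  exact Submodule.smul_mem _ _ (Submodule.mem_span_singleton_self _)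

/-- **`dim H^{1,0} ≤ 1`** for a compact connected complex curve with a nowhere-vanishing
holomorphic `1`-form. [cite: FarkasKra1992, I.1.5 and II.5.3] -/
theorem finrank_hodgePQ_one_one_zero_le_one (h1 : Module.finrank ℂ E = 1)
    {ω₀ : MForm 𝓘(ℝ, E) M ℂ 1} (hω : IsHolomorphicInCharts ω₀) (hne : ∀ x, ω₀ x ≠ 0) :
    Module.finrank ℂ ↥(hodgePQ E M 1 1 0) ≤ 1 := by
  set v := complexDeRhamCohomology.mk E M 1 ⟨ω₀, hω.mem_cclosedSmoothForms h1⟩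
  haveI : Module.Finite ℂ ↥(ℂ ∙ v) := Module.Finite.span_of_finite ℂ (Set.finite_singleton v)
  refine (Submodule.finrank_mono (hodgePQ_one_one_zero_le_span h1 hω hne)).trans ?_
  exact (finrank_span_le_card ({v} : Set _)).trans (by simp)

/-- **`H^{0,1} ⊆ ℂ · [ω̄₀]`**: a closed smooth `(0,1)`-form is the conjugate of a closed smooth
`(1,0)`-form (`IsOfType.conj`, `conj_mem_cclosedSmoothForms_holds`), hence a constant multiple of
`ω̄₀`. [cite: FarkasKra1992, I.1.5 and II.5.3] [cite: VoisinHodgeI2002, §2.3.1] -/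
theorem hodgePQ_one_zero_one_le_span (h1 : Module.finrank ℂ E = 1) {ω₀ : MForm 𝓘(ℝ, E) M ℂ 1}
    (hω : IsHolomorphicInCharts ω₀) (hne : ∀ x, ω₀ x ≠ 0) :
    hodgePQ E M 1 0 1 ≤
      ℂ ∙ complexDeRhamCohomology.mk E M 1
        ⟨ω₀.conj, conj_mem_cclosedSmoothForms_holds (hω.mem_cclosedSmoothForms h1)⟩ := by
  rw [hodgePQ]
  refine Submodule.span_le.2 ?_
  rintro _ ⟨α, hα, rfl⟩
  -- `ᾱ` is a closed smooth `(1,0)`-form, hence `ᾱ = c ω₀` and `α = c̄ ω̄₀`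
  have hconj : (α : MForm 𝓘(ℝ, E) M ℂ 1).conj ∈ cclosedSmoothForms E M 1 :=
    conj_mem_cclosedSmoothForms_holds α.2
  obtain ⟨hs, hc⟩ := (mem_cclosedSmoothForms_iff _).1 hconj
  obtain ⟨c, hcα⟩ := exists_eq_const_smul_of_isClosedForm h1 hs hc hα.conj hω hne
  have hα' : (α : MForm 𝓘(ℝ, E) M ℂ 1) = starRingEnd ℂ c • ω₀.conj := by
    rw [← MForm.conj_conj (α : MForm 𝓘(ℝ, E) M ℂ 1), hcα, MForm.conj_smul]
  have hα'' : α = starRingEnd ℂ c •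
      ⟨ω₀.conj, conj_mem_cclosedSmoothForms_holds (hω.mem_cclosedSmoothForms h1)⟩ :=
    Subtype.ext hα'
  rw [hα'', map_smul]
  exact Submodule.smul_mem _ _ (Submodule.mem_span_singleton_self _)

/-- **`dim H^{0,1} ≤ 1`** for a compact connected complex curve with a nowhere-vanishing
holomorphic `1`-form. [cite: FarkasKra1992, I.1.5 and II.5.3] -/
theorem finrank_hodgePQ_one_zero_one_le_one (h1 : Module.finrank ℂ E = 1)
    {ω₀ : MForm 𝓘(ℝ, E) M ℂ 1} (hω : IsHolomorphicInCharts ω₀) (hne : ∀ x, ω₀ x ≠ 0) :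
    Module.finrank ℂ ↥(hodgePQ E M 1 0 1) ≤ 1 := by
  set v := complexDeRhamCohomology.mk E M 1
    ⟨ω₀.conj, conj_mem_cclosedSmoothForms_holds (hω.mem_cclosedSmoothForms h1)⟩
  haveI : Module.Finite ℂ ↥(ℂ ∙ v) := Module.Finite.span_of_finite ℂ (Set.finite_singleton v)
  refine (Submodule.finrank_mono (hodgePQ_one_zero_one_le_span h1 hω hne)).trans ?_
  exact (finrank_span_le_card ({v} : Set _)).trans (by simp)

end Global

end Literature.Geometry.Kaehler

end
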